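import Literature.RepresentationTheory.Virasoro.VermaModuleTorsionFree
import Mathlib.Algebra.DirectSum.Module

/-!
# The contravariant (Shapovalov) form on Verma modules over the Virasoro algebra

On the Verma module `V(c,h)` there is a unique bilinear form with `⟨v_{c,h}, v_{c,h}⟩ = 1` and
`⟨L_n x, y⟩ = ⟨x, L_{-n} y⟩` (contravariance for the anti-involution `σ(L_n) = L_{-n}`); it is
symmetric, different weight spaces are orthogonal, and its radical is a graded subrepresentation
containing every singular vector of positive level (Iohara–Koga §3.1.2 and §4.4.1, eq. (4.15);
Kac–Raina Prop. 3.4). We construct it from the vacuum expectation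
`ε : V(c,h) → ℂ` (the `v_{c,h}`-component in `V(c,h) = ⊕_N V(c,h)_{h+N}`, `Verma.vacuumCoeff`) and
the anti-involution `σ` of the free algebra `ℂ⟨x_n⟩` (`Verma.sigma`): `⟨[X], y⟩ := ε(σ(X) · y)`
(`Verma.form`), and prove: contravariance (`form_L_left`), symmetry (`form_comm`, by uniqueness of
contravariant forms, `form_eq_of_contravariant`), orthogonality of levels (`form_eq_zero_of_ne`),
the radical `rad` is invariant and graded and contains the singular vectors, and — by
torsion-freeness of `V(c,h)` — the radical meets `V(c,h)_{h+N}` non-trivially as soon as there is a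
singular vector of level `1 ≤ M ≤ N` (`rad_inf_levelSpace_ne_bot_of_singular`).

## Not here

The Gram determinants `det(c,h)_N` and the Kac determinant formula (Iohara–Koga Theorem 4.2).
-/

noncomputable section

namespace Literature.RepresentationTheory.Virasoro

namespace Verma

variable {c h : ℂ}

/-! ### The level decomposition is an internal direct sum; the vacuum expectation -/

/-- The level spaces of `V(c,h)` are independent. [cite: IoharaKoga2011, §4.4.1 (M(c,h) = ⊕ₙ M(c,h)_{h+n})] -/
theorem iSupIndep_levelSpace : iSupIndep fun N : ℕ => (rep c h).levelSpace (hw c h) N := by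
  have h1 : (fun N : ℕ => (rep c h).levelSpace (hw c h) N) =
      (fun μ : ℂ => (rep c h).genWeightSpace μ) ∘ fun N : ℕ => (h + N : ℂ) := by
    funext N
    exact (genWeightSpace_eq_levelSpace N).symm
  rw [h1]
  refine (Module.End.independent_maxGenEigenspace ((rep c h).L 0)).comp fun N M hNM => ?_
  exact_mod_cast add_left_cancel hNM

/-- **`V(c,h) = ⊕_N V(c,h)_{h+N}`** as an internal direct sum. [cite: IoharaKoga2011, §4.4.1] -/
theorem isInternal_levelSpace :
    DirectSum.IsInternal fun N : ℕ => (rep c h).levelSpace (hw c h) N :=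
  DirectSum.isInternal_submodule_of_iSupIndep_of_iSup_eq_top iSupIndep_levelSpace
    ((rep c h).iSup_levelSpace_eq_top isPrimary_hw generated_hw_eq_top)

/-- The projection onto the level-`N` component. [folklore] -/
def levelProj (N : ℕ) : Verma c h →ₗ[ℂ] (rep c h).levelSpace (hw c h) N :=
  (DirectSum.component ℂ ℕ (fun N => (rep c h).levelSpace (hw c h) N) N).comp
    (LinearEquiv.ofBijective (DirectSum.coeLinearMap fun N : ℕ => (rep c h).levelSpace (hw c h) N)
      isInternal_levelSpace).symm.toLinearMap

/-- The projection is the identity on its level. [folklore] -/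
theorem levelProj_of_mem {N : ℕ} {x : Verma c h} (hx : x ∈ (rep c h).levelSpace (hw c h) N) :
    (levelProj N x : Verma c h) = x := by
  rw [levelProj, LinearMap.comp_apply, LinearEquiv.coe_toLinearMap, ← DirectSum.apply_eq_component,
    isInternal_levelSpace.ofBijective_coeLinearMap_of_mem hx]

/-- The projection kills the other levels. [folklore] -/
theorem levelProj_of_mem_ne {N M : ℕ} (hNM : M ≠ N) {x : Verma c h}
    (hx : x ∈ (rep c h).levelSpace (hw c h) M) : levelProj N x = 0 := by
  rw [levelProj, LinearMap.comp_apply, LinearEquiv.coe_toLinearMap, ← DirectSum.apply_eq_component,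
    isInternal_levelSpace.ofBijective_coeLinearMap_of_mem_ne hNM hx]

/-- The level-`0` space is the line spanned by the highest-weight vector. [folklore] -/
theorem levelSpace_zero : (rep c h).levelSpace (hw c h) 0 = ℂ ∙ hw c h := by
  rw [VirasoroRep.levelSpace]
  congr 1
  ext x
  simp only [Set.mem_range, Set.mem_singleton_iff]
  constructor
  · rintro ⟨p, rfl⟩
    have hp : p.parts = 0 := Multiset.eq_zero_of_forall_notMem fun a ha => by
      have := Nat.Partition.le_of_mem_parts ha
      have := p.parts_pos ha
      omega
    rw [VirasoroRep.partitionVector, hp, Multiset.sort_zero, List.reverse_nil, VirasoroRep.pbwVector_nil]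
  · rintro rfl
    refine ⟨Nat.Partition.indiscrete 0, ?_⟩
    rw [VirasoroRep.partitionVector, show (Nat.Partition.indiscrete 0).parts = 0 by
      simp [Nat.Partition.indiscrete, Nat.Partition.ofSums], Multiset.sort_zero, List.reverse_nil,
      VirasoroRep.pbwVector_nil]

/-- **The vacuum expectation** `ε : V(c,h) → ℂ`, the coefficient of `v_{c,h}` in the level
decomposition (`⟨v_{c,h}^*, ·⟩`). [cite: IoharaKoga2011, §3.1.2 (the projection to the highest weight space defining the contravariant form)] -/
def vacuumCoeff : Verma c h →ₗ[ℂ] ℂ :=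
  (LinearEquiv.toSpanNonzeroSingleton ℂ (Verma c h) (hw c h) (hw_ne_zero c h)).symm.toLinearMap.comp
    ((LinearEquiv.ofEq _ _ levelSpace_zero).toLinearMap.comp (levelProj 0))

/-- `ε(x) v_{c,h}` is the level-`0` component of `x`. [folklore] -/
theorem vacuumCoeff_smul_hw (x : Verma c h) : vacuumCoeff x • hw c h = (levelProj 0 x : Verma c h) := by
  rw [vacuumCoeff, LinearMap.comp_apply, LinearMap.comp_apply, LinearEquiv.coe_toLinearMap,
    LinearEquiv.coe_toLinearMap, LinearEquiv.toSpanNonzeroSingleton_symm_apply_smul]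
  rfl

/-- `ε(v_{c,h}) = 1`. [cite: IoharaKoga2011, §4.4.1 (⟨v_{c,h}, v_{c,h}⟩ = 1)] -/
theorem vacuumCoeff_hw : vacuumCoeff (hw c h) = 1 := by
  have h1 := vacuumCoeff_smul_hw (hw c h)
  rw [levelProj_of_mem (by rw [levelSpace_zero]; exact Submodule.mem_span_singleton_self _)] at h1
  have h2 : (vacuumCoeff (hw c h) - 1) • hw c h = 0 := by
    rw [sub_smul', one_smul', h1, sub_self]
  by_contra hne
  exact hw_ne_zero c h ((smul_eq_zero.mp h2).resolve_left (sub_ne_zero.mpr hne))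

/-- `ε` kills the positive levels. [cite: IoharaKoga2011, §4.4.1] -/
theorem vacuumCoeff_of_mem {N : ℕ} (hN : N ≠ 0) {x : Verma c h}
    (hx : x ∈ (rep c h).levelSpace (hw c h) N) : vacuumCoeff x = 0 := by
  have h1 := vacuumCoeff_smul_hw x
  rw [levelProj_of_mem_ne hN hx, Submodule.coe_zero] at h1
  exact (smul_eq_zero.mp h1).resolve_right (hw_ne_zero c h)

/-- `ε ∘ L_{-n} = 0` for `n ≥ 1` (`L_{-n}` raises the level). [cite: IoharaKoga2011, §4.4.1] -/
theorem vacuumCoeff_L_neg {n : ℕ} (hn : 0 < n) (x : Verma c h) :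
    vacuumCoeff ((rep c h).L (-(n : ℤ)) x) = 0 := by
  have hx : x ∈ ⨆ N, (rep c h).levelSpace (hw c h) N := by
    rw [(rep c h).iSup_levelSpace_eq_top isPrimary_hw generated_hw_eq_top]; trivial
  induction hx using Submodule.iSup_induction' with
  | mem N x hx =>
    exact vacuumCoeff_of_mem (by omega) ((rep c h).L_neg_mem_levelSpace (hw c h) N n hn x hx)
  | zero => rw [map_zero, map_zero]
  | add x y _ _ hx hy => rw [map_add, map_add, hx, hy, add_zero]

/-- `ε ∘ (L_0 - h) = 0` (`L_0 - h` multiplies the level-`N` component by `N`). [cite: IoharaKoga2011, §4.4.1] -/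
theorem vacuumCoeff_L_zero (x : Verma c h) : vacuumCoeff ((rep c h).L 0 x) = h * vacuumCoeff x := by
  have hx : x ∈ ⨆ N, (rep c h).levelSpace (hw c h) N := by
    rw [(rep c h).iSup_levelSpace_eq_top isPrimary_hw generated_hw_eq_top]; trivial
  induction hx using Submodule.iSup_induction' with
  | mem N x hx =>
    rw [(rep c h).L_zero_apply_of_mem_levelSpace isPrimary_hw.mem_weightSpace hx, map_smul, smul_eq_mul]
    rcases Nat.eq_zero_or_pos N with rfl | hN
    · simp
    · rw [vacuumCoeff_of_mem (by omega) hx, mul_zero, mul_zero]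
  | zero => rw [map_zero, map_zero, mul_zero]
  | add x y _ _ hx hy => rw [map_add, map_add, hx, hy, map_add, mul_add]

/-! ### The anti-involution `σ` of `ℂ⟨x_n⟩` -/

/-- The anti-involution `σ(x_n) = x_{-n}` of the free algebra, as an algebra map to the opposite
algebra. [cite: IoharaKoga2011, §1.2.3 (σ(L_n) = L_{-n}, σ(C) = C)] -/
def sigmaOp : FreeAlgebra ℂ ℤ →ₐ[ℂ] (FreeAlgebra ℂ ℤ)ᵐᵒᵖ :=
  FreeAlgebra.lift ℂ fun n => MulOpposite.op (gen (-n))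

/-- The anti-involution `σ` of `ℂ⟨x_n : n ∈ ℤ⟩`, `σ(x_n) = x_{-n}`, `σ(XY) = σ(Y) σ(X)`.
[cite: IoharaKoga2011, §1.2.3] -/
def sigma (X : FreeAlgebra ℂ ℤ) : FreeAlgebra ℂ ℤ := MulOpposite.unop (sigmaOp X)

/-- `σ(x_n) = x_{-n}`. [cite: IoharaKoga2011, §1.2.3] -/
@[simp] theorem sigma_gen (n : ℤ) : sigma (gen n) = gen (-n) := by
  simp [sigma, sigmaOp, gen]

/-- `σ` is additive. [folklore] -/
@[simp] theorem sigma_add (X Y : FreeAlgebra ℂ ℤ) : sigma (X + Y) = sigma X + sigma Y := by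
  simp [sigma]

/-- `σ` reverses products. [folklore] -/
@[simp] theorem sigma_mul (X Y : FreeAlgebra ℂ ℤ) : sigma (X * Y) = sigma Y * sigma X := by
  simp [sigma]

/-- `σ` fixes scalars. [folklore] -/
@[simp] theorem sigma_algebraMap (r : ℂ) : sigma (algebraMap ℂ (FreeAlgebra ℂ ℤ) r) = algebraMap ℂ _ r := by
  simp [sigma]

/-- `σ` is `ℂ`-linear. [folklore] -/
@[simp] theorem sigma_smul (r : ℂ) (X : FreeAlgebra ℂ ℤ) : sigma (r • X) = r • sigma X := by
  simp [sigma]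

/-- `σ(1) = 1`. [folklore] -/
@[simp] theorem sigma_one : sigma (1 : FreeAlgebra ℂ ℤ) = 1 := by simp [sigma]

/-- `σ(X - Y) = σ(X) - σ(Y)`. [folklore] -/
@[simp] theorem sigma_sub (X Y : FreeAlgebra ℂ ℤ) : sigma (X - Y) = sigma X - sigma Y := by
  simp [sigma]

/-- `σ` maps the Virasoro relator `(m,n)` to the relator `(-n,-m)`. [cite: IoharaKoga2011, §1.2.3 (σ is an anti-involution of Vir)] -/
theorem sigma_relator (c : ℂ) (m n : ℤ) : sigma (relator c m n) = relator c (-n) (-m) := by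
  simp only [relator, sigma_sub, sigma_mul, sigma_gen, sigma_smul, sigma_algebraMap]
  have hct : centralTerm c m n = centralTerm c (-n) (-m) := by
    unfold centralTerm
    by_cases hmn : m + n = 0
    · have : n = -m := by omega
      subst this
      simp
    · rw [if_neg hmn, if_neg (by omega)]
  rw [hct, show -n + -m = -(m + n) by ring]
  congr 2
  push_cast
  ring

/-! ### The contravariant form -/

/-- `σ` as a `ℂ`-linear map. [folklore] -/
def sigmaₗ : FreeAlgebra ℂ ℤ →ₗ[ℂ] FreeAlgebra ℂ ℤ :=
  (MulOpposite.opLinearEquiv ℂ (M := FreeAlgebra ℂ ℤ)).symm.toLinearMap.comp sigmaOp.toLinearMap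

/-- Unfolding of `sigmaₗ`. [folklore] -/
@[simp] theorem sigmaₗ_apply (X : FreeAlgebra ℂ ℤ) : sigmaₗ X = sigma X := rfl

/-- The pre-form on the free algebra: `X ↦ (y ↦ ε(σ(X) · y))`. [cite: IoharaKoga2011, §3.1.2] -/
def preform : FreeAlgebra ℂ ℤ →ₗ[ℂ] (Verma c h →ₗ[ℂ] ℂ) :=
  (LinearMap.llcomp ℂ (Verma c h) (Verma c h) ℂ vacuumCoeff).comp
    ((Algebra.lsmul ℂ ℂ (Verma c h)).toLinearMap.comp sigmaₗ)

/-- Unfolding of the pre-form. [folklore] -/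
theorem preform_apply (X : FreeAlgebra ℂ ℤ) (y : Verma c h) :
    preform (c := c) (h := h) X y = vacuumCoeff (sigma X • y) := rfl

/-- The pre-form kills the Verma left ideal (the relators act by `0`, `x_{-n}` raises the level,
`x_0 - h` kills the vacuum component). [cite: IoharaKoga2011, §3.1.2] -/
theorem vermaIdeal_le_ker_preform :
    (vermaIdeal c h).restrictScalars ℂ ≤ LinearMap.ker (preform (c := c) (h := h)) := by
  intro X hX
  rw [Submodule.restrictScalars_mem] at hX
  rw [LinearMap.mem_ker]
  induction hX using Submodule.span_induction with
  | mem X hX =>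
    refine LinearMap.ext fun y => ?_
    rw [preform_apply, LinearMap.zero_apply]
    rcases hX with (⟨m, n, b, rfl⟩ | ⟨n, hn, rfl⟩) | hX
    · rw [sigma_mul, mul_smul, sigma_relator, relator_smul, smul_zero, map_zero]
    · obtain ⟨k, rfl⟩ : ∃ k : ℕ, n = k := ⟨n.toNat, by omega⟩
      rw [sigma_gen, ← L_apply, vacuumCoeff_L_neg (by exact_mod_cast hn)]
    · rw [Set.mem_singleton_iff] at hX
      rw [hX, sigma_sub, sigma_gen, sigma_algebraMap, neg_zero, sub_smul, ← L_apply, algebraMap_smul,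
        map_sub, vacuumCoeff_L_zero, map_smul, smul_eq_mul, sub_self]
  | zero => rw [map_zero]
  | add X Y _ _ hX hY => rw [map_add, hX, hY, add_zero]
  | smul a X _ hX =>
    refine LinearMap.ext fun y => ?_
    have := LinearMap.congr_fun hX (sigma a • y)
    rw [preform_apply, LinearMap.zero_apply] at this
    rw [preform_apply, LinearMap.zero_apply, smul_eq_mul, sigma_mul, mul_smul, this]

/-- **The contravariant (Shapovalov) form** `⟨·,·⟩ : V(c,h) × V(c,h) → ℂ`,
`⟨[X], y⟩ = ε(σ(X) · y)`. [cite: IoharaKoga2011, §3.1.2 and §4.4.1 (eq. (4.15))] -/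
def form : Verma c h →ₗ[ℂ] Verma c h →ₗ[ℂ] ℂ :=
  (((vermaIdeal c h).restrictScalars ℂ).liftQ preform vermaIdeal_le_ker_preform).comp
    (Submodule.Quotient.restrictScalarsEquiv ℂ (vermaIdeal c h)).symm.toLinearMap

/-- The form on classes of words. [cite: IoharaKoga2011, §3.1.2] -/
theorem form_mk (X : FreeAlgebra ℂ ℤ) (y : Verma c h) :
    form (Submodule.Quotient.mk X) y = vacuumCoeff (sigma X • y) := by
  simp [form, preform_apply]

/-- `⟨a · v_{c,h}, y⟩ = ε(σ(a) · y)`. [cite: IoharaKoga2011, §3.1.2] -/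
theorem form_smul_hw (a : FreeAlgebra ℂ ℤ) (y : Verma c h) :
    form (a • hw c h) y = vacuumCoeff (sigma a • y) := by
  rw [smul_hw, form_mk]

/-- **Normalisation**: `⟨v_{c,h}, v_{c,h}⟩ = 1`. [cite: IoharaKoga2011, §4.4.1 (1)] -/
theorem form_hw_hw : form (hw c h) (hw c h) = 1 := by
  rw [hw, form_mk, sigma_one, one_smul, ← hw, vacuumCoeff_hw]

/-- `⟨v_{c,h}, y⟩ = ε(y)`. [cite: IoharaKoga2011, §4.4.1] -/
theorem form_hw_left (y : Verma c h) : form (hw c h) y = vacuumCoeff y := by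
  rw [hw, form_mk, sigma_one, one_smul]

/-- **Contravariance**: `⟨L_n x, y⟩ = ⟨x, L_{-n} y⟩`. [cite: IoharaKoga2011, §4.4.1 (2), eq. (4.15)] -/
theorem form_L_left (n : ℤ) (x y : Verma c h) :
    form ((rep c h).L n x) y = form x ((rep c h).L (-n) y) := by
  obtain ⟨a, rfl⟩ := exists_smul_hw x
  rw [L_apply, ← mul_smul, form_smul_hw, form_smul_hw, sigma_mul, sigma_gen, mul_smul, L_apply]

/-- Contravariance on the right: `⟨x, L_n y⟩ = ⟨L_{-n} x, y⟩`. [cite: IoharaKoga2011, eq. (4.15)] -/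
theorem form_L_right (n : ℤ) (x y : Verma c h) :
    form x ((rep c h).L n y) = form ((rep c h).L (-n) x) y := by
  rw [form_L_left, neg_neg]

/-! ### Uniqueness of contravariant forms; symmetry -/

/-- `⟨v_{c,h}, y⟩ = 0` for `y` of positive level. [cite: IoharaKoga2011, §4.4.1 (1)] -/
theorem form_hw_of_mem {N : ℕ} (hN : N ≠ 0) {y : Verma c h} (hy : y ∈ (rep c h).levelSpace (hw c h) N) :
    form (hw c h) y = 0 := by
  rw [form_hw_left, vacuumCoeff_of_mem hN hy]

/-- A positive word on `v_{c,h}` starts with a creation operator. [folklore] -/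
theorem exists_eq_L_neg_of_partition {N : ℕ} (hN : N ≠ 0) (p : Nat.Partition N) :
    ∃ (k : ℕ) (z : Verma c h), 0 < k ∧ (rep c h).partitionVector p (hw c h) = (rep c h).L (-(k : ℤ)) z := by
  obtain ⟨l, -, hpos, hsum, hl⟩ := (rep c h).exists_list_of_partition (hw c h) p
  cases l with
  | nil => simp at hsum; omega
  | cons k l => exact ⟨k, (rep c h).pbwVector l (hw c h), hpos k List.mem_cons_self, hl⟩

/-- **Uniqueness of contravariant forms**: a bilinear form `β` on `V(c,h)` with
`β(L_n x, y) = β(x, L_{-n} y)` is `β(v,v)` times the Shapovalov form. [cite: IoharaKoga2011, §3.1.2 ("There exists a unique bilinear form …"), §4.4.1] -/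
theorem form_eq_of_contravariant (β : Verma c h →ₗ[ℂ] Verma c h →ₗ[ℂ] ℂ)
    (hβ : ∀ (n : ℤ) (x y : Verma c h), β ((rep c h).L n x) y = β x ((rep c h).L (-n) y))
    (x y : Verma c h) : β x y = β (hw c h) (hw c h) * form x y := by
  -- Step 1: on the highest-weight vector
  have hv : ∀ y, β (hw c h) y = β (hw c h) (hw c h) * form (hw c h) y := by
    intro y
    have hy : y ∈ ⨆ N, (rep c h).levelSpace (hw c h) N := by
      rw [(rep c h).iSup_levelSpace_eq_top isPrimary_hw generated_hw_eq_top]; trivial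
    induction hy using Submodule.iSup_induction' with
    | mem N y hy =>
      rcases Nat.eq_zero_or_pos N with rfl | hN
      · rw [levelSpace_zero, Submodule.mem_span_singleton] at hy
        obtain ⟨t, rfl⟩ := hy
        rw [map_smul, map_smul, smul_eq_mul, smul_eq_mul, form_hw_hw, mul_one, mul_comm]
      · rw [form_hw_of_mem (by omega) hy, mul_zero]
        induction hy using Submodule.span_induction with
        | mem y hy =>
          obtain ⟨p, rfl⟩ := hy
          obtain ⟨k, z, hk, hz⟩ := exists_eq_L_neg_of_partition (c := c) (h := h) (by omega) p
          dsimp only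
          rw [hz, ← neg_neg (-(k : ℤ)), ← hβ, neg_neg, L_hw_of_pos (by exact_mod_cast hk), map_zero,
            LinearMap.zero_apply]
        | zero => rw [map_zero]
        | add y z _ _ hy hz => rw [map_add, hy, hz, add_zero]
        | smul a y _ hy => rw [map_smul, hy, smul_zero]
    | zero => rw [map_zero, map_zero, mul_zero]
    | add y z _ _ hy hz => rw [map_add, map_add, hy, hz, mul_add]
  -- Step 2: move the creation operators of `x` to the right
  have hx : x ∈ (rep c h).pbwSpan (hw c h) := by rw [pbwSpan_hw_eq_top]; trivial
  induction hx using Submodule.span_induction generalizing y with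
  | mem x hx =>
    obtain ⟨l, rfl⟩ := hx
    induction l generalizing y with
    | nil => exact hv y
    | cons k l ih =>
      dsimp only at ih ⊢
      rw [VirasoroRep.pbwVector_cons, hβ, ih, form_L_left]
  | zero => simp
  | add x x' _ _ hx hx' => rw [map_add, map_add, LinearMap.add_apply, LinearMap.add_apply, hx, hx', mul_add]
  | smul a x _ hx => rw [map_smul, map_smul, LinearMap.smul_apply, LinearMap.smul_apply, hx, smul_eq_mul,
      smul_eq_mul, mul_left_comm]

/-- **Symmetry** of the contravariant form. [cite: IoharaKoga2011, §3.1.2] -/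
theorem form_comm (x y : Verma c h) : form x y = form y x := by
  have h1 := form_eq_of_contravariant (c := c) (h := h) form.flip (fun n x y => by
    rw [LinearMap.flip_apply, LinearMap.flip_apply, form_L_right]) y x
  rw [LinearMap.flip_apply, LinearMap.flip_apply, form_hw_hw, one_mul] at h1
  exact h1

/-- **Different levels are orthogonal.** [cite: IoharaKoga2011, §4.4.1 (1 after (4.15))] -/
theorem form_eq_zero_of_ne {N M : ℕ} (hNM : N ≠ M) {x y : Verma c h}
    (hx : x ∈ (rep c h).levelSpace (hw c h) N) (hy : y ∈ (rep c h).levelSpace (hw c h) M) :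
    form x y = 0 := by
  have h1 := form_L_left (c := c) (h := h) 0 x y
  rw [neg_zero, (rep c h).L_zero_apply_of_mem_levelSpace isPrimary_hw.mem_weightSpace hx,
    (rep c h).L_zero_apply_of_mem_levelSpace isPrimary_hw.mem_weightSpace hy, map_smul, map_smul,
    LinearMap.smul_apply, smul_eq_mul, smul_eq_mul] at h1
  have h2 : ((N : ℂ) - M) * form x y = 0 := by linear_combination h1
  have h3 : ((N : ℂ) - M) ≠ 0 := sub_ne_zero.mpr (by exact_mod_cast hNM)
  exact (mul_eq_zero.mp h2).resolve_left h3

/-! ### The radical -/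

/-- The radical of the contravariant form. [cite: IoharaKoga2011, §4.4.1 (2: rad⟨,⟩ is the maximal proper submodule)] -/
def rad : Submodule ℂ (Verma c h) := LinearMap.ker form

/-- `x ∈ rad ↔ ⟨x, y⟩ = 0` for all `y`. [folklore] -/
theorem mem_rad {x : Verma c h} : x ∈ rad ↔ ∀ y, form x y = 0 := by
  rw [rad, LinearMap.mem_ker, LinearMap.ext_iff]
  rfl

/-- The radical is a subrepresentation. [cite: IoharaKoga2011, §4.4.1 (2)] -/
theorem isInvariant_rad : (rep c h).IsInvariant (rad (c := c) (h := h)) := by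
  intro n x hx
  rw [mem_rad] at hx ⊢
  intro y
  rw [form_L_left, hx]

/-- The highest-weight vector is not in the radical (which is therefore proper).
[cite: IoharaKoga2011, §4.4.1 (2)] -/
theorem hw_not_mem_rad : hw c h ∉ rad := fun hv => by
  have := mem_rad.mp hv (hw c h)
  rw [form_hw_hw] at this
  exact one_ne_zero this

/-- `⟨x, y⟩ = ⟨x_N, y⟩` for `y` of level `N` (`x_N` the level-`N` component of `x`). [folklore] -/
theorem form_levelProj {N : ℕ} (x : Verma c h) {y : Verma c h} (hy : y ∈ (rep c h).levelSpace (hw c h) N) :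
    form x y = form (levelProj N x : Verma c h) y := by
  have hx : x ∈ ⨆ M, (rep c h).levelSpace (hw c h) M := by
    rw [(rep c h).iSup_levelSpace_eq_top isPrimary_hw generated_hw_eq_top]; trivial
  induction hx using Submodule.iSup_induction' with
  | mem M x hx =>
    by_cases hMN : M = N
    · subst hMN; rw [levelProj_of_mem hx]
    · rw [levelProj_of_mem_ne hMN hx, Submodule.coe_zero, map_zero, LinearMap.zero_apply,
        form_eq_zero_of_ne hMN hx hy]
  | zero => simp
  | add x x' _ _ hx hx' => rw [map_add, LinearMap.add_apply, hx, hx', map_add, Submodule.coe_add, map_add,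
      LinearMap.add_apply]

/-- **The radical is graded**: the level components of an element of the radical lie in the
radical. [cite: IoharaKoga2011, §3.1.2] -/
theorem levelProj_mem_rad {x : Verma c h} (hx : x ∈ rad) (N : ℕ) : (levelProj N x : Verma c h) ∈ rad := by
  rw [mem_rad] at hx ⊢
  intro y
  have hy : y ∈ ⨆ M, (rep c h).levelSpace (hw c h) M := by
    rw [(rep c h).iSup_levelSpace_eq_top isPrimary_hw generated_hw_eq_top]; trivial
  induction hy using Submodule.iSup_induction' with
  | mem M y hy =>
    by_cases hMN : N = M
    · subst hMN; rw [← form_levelProj x hy, hx]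
    · exact form_eq_zero_of_ne hMN (levelProj N x).2 hy
  | zero => rw [map_zero]
  | add y y' _ _ hy hy' => rw [map_add, hy, hy', add_zero]

/-- **Singular vectors of positive level lie in the radical.** [cite: IoharaKoga2011, Proposition 3.4 / §4.4.1 (2)] -/
theorem mem_rad_of_singular {N : ℕ} (hN : N ≠ 0) {w : Verma c h} (hw' : w ∈ (rep c h).levelSpace (hw c h) N)
    (hsing : ∀ m : ℕ, 1 ≤ m → (rep c h).L m w = 0) : w ∈ rad := by
  rw [mem_rad]
  intro y
  have hy : y ∈ (rep c h).pbwSpan (hw c h) := by rw [pbwSpan_hw_eq_top]; trivial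
  induction hy using Submodule.span_induction with
  | mem y hy =>
    obtain ⟨l, rfl⟩ := hy
    induction l with
    | nil =>
      dsimp only
      rw [VirasoroRep.pbwVector_nil, form_comm, form_hw_of_mem hN hw']
    | cons k l ih =>
      dsimp only at ih ⊢
      rw [VirasoroRep.pbwVector_cons, form_L_right, neg_neg]
      rcases Nat.eq_zero_or_pos k with rfl | hk
      · rw [Int.natCast_zero, (rep c h).L_zero_apply_of_mem_levelSpace isPrimary_hw.mem_weightSpace hw',
          map_smul, LinearMap.smul_apply, ih, smul_zero]
      · rw [hsing k hk, map_zero, LinearMap.zero_apply]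
  | zero => rw [map_zero]
  | add y y' _ _ hy hy' => rw [map_add, hy, hy', add_zero]
  | smul a y _ hy => rw [map_smul, hy, smul_zero]

/-- Descendants of a level-`M` vector along a positive word of degree `K` have level `M + K`.
[folklore] -/
theorem pbwVector_mem_levelSpace_of_mem {M : ℕ} {x : Verma c h}
    (hx : x ∈ (rep c h).levelSpace (hw c h) M) {l : List ℕ} (hl : ∀ k ∈ l, 0 < k) :
    (rep c h).pbwVector l x ∈ (rep c h).levelSpace (hw c h) (M + l.sum) := by
  induction l with
  | nil => simpa using hx
  | cons k l ih =>
    rw [VirasoroRep.pbwVector_cons, List.sum_cons, show M + (k + l.sum) = M + l.sum + k by ring]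
    exact (rep c h).L_neg_mem_levelSpace (hw c h) _ k (hl k List.mem_cons_self) _
      (ih fun j hj => hl j (List.mem_cons_of_mem k hj))

/-- `e_ℙ x ∈ V(c,h)_{h+M+K}` for `x ∈ V(c,h)_{h+M}` and `ℙ ⊢ K`. [folklore] -/
theorem partitionVector_mem_levelSpace_of_mem {M K : ℕ} {x : Verma c h}
    (hx : x ∈ (rep c h).levelSpace (hw c h) M) (p : Nat.Partition K) :
    (rep c h).partitionVector p x ∈ (rep c h).levelSpace (hw c h) (M + K) := by
  obtain ⟨l, -, hpos, hsum, hl⟩ := (rep c h).exists_list_of_partition x p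
  rw [hl, ← hsum]
  exact pbwVector_mem_levelSpace_of_mem hx hpos

/-- **A singular vector of level `M ≥ 1` makes the form degenerate in every level `N ≥ M`**:
`rad ∩ V(c,h)_{h+N} ≠ 0` (its descendants `e_ℙ w`, `ℙ ⊢ N - M`, are non-zero by torsion-freeness
and lie in the radical). [cite: IoharaKoga2011, Lemma 4.14 (proof) and eq. (4.20)] -/
theorem rad_inf_levelSpace_ne_bot_of_singular {M N : ℕ} (hM : M ≠ 0) (hMN : M ≤ N) {w : Verma c h}
    (hw0 : w ≠ 0) (hwlev : w ∈ (rep c h).levelSpace (hw c h) M)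
    (hsing : ∀ m : ℕ, 1 ≤ m → (rep c h).L m w = 0) :
    rad ⊓ (rep c h).levelSpace (hw c h) N ≠ ⊥ := by
  rw [Submodule.ne_bot_iff]
  let p₀ : Nat.Partition (N - M) := Nat.Partition.indiscrete (N - M)
  refine ⟨(rep c h).partitionVector p₀ w, ⟨?_, ?_⟩, ?_⟩
  · exact (rep c h).pbwVector_mem isInvariant_rad (mem_rad_of_singular hM hwlev hsing) _
  · have := partitionVector_mem_levelSpace_of_mem hwlev p₀
    rwa [show M + (N - M) = N by omega] at this
  · exact (linearIndependent_partitionVector_of_ne_zero hwlev hw0 (N - M)).ne_zero p₀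

end Verma

end Literature.RepresentationTheory.Virasoro

end
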